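import Literature.AlgebraicGeometry.Morphisms.TwoPieceCompactification
import Literature.AlgebraicGeometry.Morphisms.NagataCompactification
import Literature.AlgebraicGeometry.Morphisms.AffineSpaceCompactification
import HarnessLib

/-!
# Nagata's compactification theorem over Noetherian and over affine bases, from
# Raynaud–Gruson flattening (Stacks 0F41)

Topic: `Literature/AlgebraicGeometry/Morphisms`. The Stacks Project, Tag 0F41 (More on Flatness,
Theorem 38.33.8): "Let `S` be a quasi-compact and quasi-separated scheme. Let `X → S` be a
separated, finite type morphism. Then `X` has a compactification over `S`." The named fact
`NagataCompactification` (`NagataCompactification.lean`) is this statement. Its printed proof has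
two halves: the reduction of a qcqs base to the Noetherian case (absolute Noetherian
approximation, Limits Prop. 32.5.4 = Thomason–Trobaugh C.9, and Limits Prop. 32.9.6) and the
Noetherian case (dense affine cover, compactification of the affine pieces in `𝐏ⁿ_S`, and the
two-piece lemma Tag 0F40 applied `n − 1` times). This file ASSEMBLES the Noetherian case and the
affine-base case from the tree:

* the induction is `exists_compactification_of_isNoetherian_of_twoPiece` and the affine pieces
  `exists_compactification_of_isAffine` (`NagataCompactification.lean`,
  `AffineSpaceCompactification.lean`, both unconditional);
* the two-piece lemma is `h0F40_of_stacks081R` (`TwoPieceCompactification.lean`), proved from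
  Raynaud–Gruson flattening by blowing up, i.e. CONDITIONAL on the named fact
  `Resolution.Stacks081R` (Stacks 081R = Raynaud–Gruson 1971, Thm. 5.2.2) — the ONLY undischarged
  input of everything below;
* the affine-base case follows from the Noetherian case by the tree's absolute Noetherian
  approximation over an affine base (`Limits.exists_finiteTypeModel`, Stacks 09ZP/01ZA), exactly as
  in `exists_compactification_affineBase_of_twoPiece`;
* bases which are separated of finite type over an affine scheme (e.g. proper schemes over a
  field, the situation of every use of `NagataCompactification` in the tree) reduce to the affine
  base by Stacks 0A9Z (the graph in `X̄ ×_B S`, `GraphClosure`).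

* `nagataCompactification_of_isNoetherian_of_stacks081R` — **Tag 0F41 for `S` Noetherian**;
* `nagataCompactification_affineBase_of_stacks081R` — **Tag 0F41 for `S` affine**;
* `nagataCompactification_over_affine_of_stacks081R` — **Tag 0F41 for `S` separated of finite
  type over an affine scheme** (Stacks 0A9Z).

What is NOT here: the literal qcqs-base statement `NagataCompactification`, which in addition
needs absolute Noetherian approximation of qcqs schemes (Thomason–Trobaugh C.9 / Stacks 01ZA for
non-affine `S`), not in the tree.

## References

* The Stacks Project, Tag 0F41 (Theorem 38.33.8) and its proof; Tags 0F40, 0A9Z, 09ZP, 081R.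
  [StacksProject]
* B. Conrad, *Deligne's notes on Nagata compactifications*, J. Ramanujan Math. Soc. 22 (2007),
  Thm. 4.1. [Conrad2007]
* M. Raynaud, L. Gruson, *Critères de platitude et de projectivité*, Invent. Math. 13 (1971),
  Thm. 5.2.2. [RaynaudGruson1971]
-/

noncomputable section

universe u

open CategoryTheory CategoryTheory.Limits AlgebraicGeometry TopologicalSpace
open Literature.AlgebraicGeometry.Resolution

namespace Literature.AlgebraicGeometry.Morphisms

/-- **Nagata's theorem over a Noetherian base, from Raynaud–Gruson flattening** (Stacks 0F41,
Noetherian case): every separated morphism locally of finite type `f : X → S` to a Noetherian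
scheme `S` (so `X` is Noetherian as soon as it is quasi-compact) with `X` Noetherian has a
compactification. [cite: StacksProject, Tag 0F41 (proof, Noetherian case)] -/
theorem nagataCompactification_of_isNoetherian_of_stacks081R (hRG : Stacks081R.{u}) {X S : Scheme.{u}}
    [IsNoetherian S] [IsNoetherian X] (f : X ⟶ S) [IsSeparated f] [LocallyOfFiniteType f] :
    ∃ (Xc : Scheme.{u}) (j : X ⟶ Xc) (g : Xc ⟶ S), IsOpenImmersion j ∧ IsProper g ∧ j ≫ g = f :=
  exists_compactification_of_isNoetherian_of_twoPiece f
    (fun U hU => by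
      haveI : IsAffine U := hU
      haveI : CompactSpace (U : Scheme.{u}) := isCompact_iff_compactSpace.mp (NoetherianSpace.isCompact _)
      exact exists_compactification_of_isAffine (U.ι ≫ f))
    (fun W W₁ W₂ hW hd h₁ h₂ => h0F40_of_stacks081R hRG f W W₁ W₂ hW hd h₁ h₂)

/-- **Nagata's theorem over an affine base, from Raynaud–Gruson flattening** (Stacks 0F41 with
the reduction to the Noetherian case over an affine base by absolute Noetherian approximation,
`Limits.exists_finiteTypeModel`; cf. `exists_compactification_affineBase_of_twoPiece`): every
separated morphism of finite type `g : Y → Spec B` has a compactification.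
[cite: StacksProject, Tag 0F41] -/
theorem nagataCompactification_affineBase_of_stacks081R (hRG : Stacks081R.{u}) {B : Type u} [CommRing B]
    {Y : Scheme.{u}} (g : Y ⟶ Spec (.of B)) [IsSeparated g] [LocallyOfFiniteType g] [QuasiCompact g] :
    ∃ (Yc : Scheme.{u}) (j : Y ⟶ Yc) (h : Yc ⟶ Spec (.of B)), IsOpenImmersion j ∧ IsProper h ∧ j ≫ h = g := by
  obtain ⟨A₀, _, φ, Y₀, p, j, hA₀, -, -, hp₁, hp₂, hp₃, hj, hjg⟩ :=
    Literature.AlgebraicGeometry.Limits.exists_finiteTypeModel g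
  haveI := hp₁
  haveI := hp₂
  haveI := hp₃
  haveI := hj
  -- `Spec A₀` and `Y₀` are Noetherian
  haveI : IsNoetherianRing (CommRingCat.of A₀) := hA₀
  haveI : IsNoetherian (Spec (CommRingCat.of A₀)) := inferInstance
  haveI : IsNoetherian Y₀ := isNoetherian_of_locallyOfFiniteType (S := Spec (.of A₀)) p
  -- compactify `Y₀ → Spec A₀`
  have hY₀ := nagataCompactification_of_isNoetherian_of_stacks081R hRG p
  -- base change to `Spec B`, then the closed immersion `Y ↪ Y₀ ×_{A₀} Spec B`
  obtain ⟨Zc, j', h', hj', hh', hfac⟩ :=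
    exists_compactification_pullback_snd p (Spec.map (CommRingCat.ofHom φ)) hY₀
  haveI := hj'
  haveI := hh'
  haveI : QuasiCompact (j' ≫ h') := hfac ▸ inferInstance
  haveI : QuasiCompact j' := .of_comp j' h'
  obtain ⟨Yc, k, h, hk, hh, hkh⟩ := exists_compactification_of_immersion (j ≫ j') h'
  exact ⟨Yc, k, h, hk, hh, by rw [hkh, Category.assoc, hfac, hjg]⟩

/-- **Nagata's theorem over a base separated and of finite type over an affine scheme** (e.g. a
proper scheme over a field), **from Raynaud–Gruson flattening**: Stacks 0A9Z ("Let `f : X → Y` be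
a morphism of schemes over `S` with `Y` separated and of finite type over `S` and `X`
compactifyable over `S`. Then `X` has a compactification over `Y`": the scheme-theoretic image of
`(j, f) : X → X̄ ×_S Y`) on top of the affine-base case. This covers every use of the named fact
`NagataCompactification` in the tree (bases `Spec k` and proper `k`-schemes).
[cite: StacksProject, Tag 0A9Z] -/
theorem nagataCompactification_over_affine_of_stacks081R (hRG : Stacks081R.{u}) {B : Type u} [CommRing B]
    {X S : Scheme.{u}} (q : S ⟶ Spec (.of B)) [IsSeparated q] [LocallyOfFiniteType q] [QuasiCompact q]
    (f : X ⟶ S) [IsSeparated f] [LocallyOfFiniteType f] [QuasiCompact f] :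
    ∃ (Xc : Scheme.{u}) (j : X ⟶ Xc) (g : Xc ⟶ S), IsOpenImmersion j ∧ IsProper g ∧ j ≫ g = f := by
  -- compactify `X` over `Spec B`
  obtain ⟨N, j₀, gN, hj₀, hgN, hfac⟩ := nagataCompactification_affineBase_of_stacks081R hRG (f ≫ q)
  haveI := hj₀
  haveI := hgN
  haveI : CompactSpace X := QuasiCompact.compactSpace_of_compactSpace (f ≫ q)
  haveI : QuasiSeparatedSpace N := quasiSeparatedSpace_of_quasiSeparated gN
  -- the graph `γ = (j₀, f) : X → N ×_B S`, quasi-compact, and its scheme-theoretic image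
  set γ : X ⟶ pullback gN q := pullback.lift j₀ f hfac with hγ
  have hγ₁ : γ ≫ pullback.fst gN q = j₀ := pullback.lift_fst _ _ _
  have hγ₂ : γ ≫ pullback.snd gN q = f := pullback.lift_snd _ _ _
  haveI : QuasiSeparatedSpace (↥(pullback gN q : Scheme.{u})) :=
    quasiSeparatedSpace_of_quasiSeparated (pullback.fst gN q)
  haveI : QuasiCompact γ := inferInstance
  haveI : QuasiCompact j₀ := inferInstance
  -- `X → im(γ)` is an open immersion (`im(γ) → N` is an isomorphism over `j₀(X)`), `im(γ) → S` proper
  obtain ⟨hs, -⟩ := GraphClosure.isOpenImmersion_toImage_and_range j₀ (pullback.fst gN q) γ hγ₁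
  haveI := hs
  refine ⟨γ.image, γ.toImage, γ.imageι ≫ pullback.snd gN q, inferInstance, inferInstance, ?_⟩
  rw [Scheme.Hom.toImage_imageι_assoc, hγ₂]

end Literature.AlgebraicGeometry.Morphisms

end
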